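import Literature.Probability.Percolation.PercolationProofs
import Literature.Probability.Percolation.TwoPointFunction
import Mathlib.LinearAlgebra.Matrix.PosDef
import HarnessLib

/-!
# The connectivity function is a positive-semidefinite kernel (solo seat `solo-CriticalPhenomena-informed`, break point 1)

For ANY bond configuration `ω` on any vertex type, "joined by an open path" is an equivalence
relation, so the matrix `[x_i ↔ x_j]_{i,j}` is a Gram matrix: `Σ_{i,j} c_i c_j 1[x_i ↔ x_j] =
Σ_{clusters K} (Σ_{i : x_i ∈ K} c_i)² ≥ 0` (`quadForm_indicator_openConn_nonneg`, from the purely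
algebraic fibre identity `sum_sum_ite_eq_eq_sum_sq`). Integrating against any finite measure `μ` on
configurations (`V` countable, so that `{x ↔ y}` is measurable): the kernel
`(x, y) ↦ μ(x ↔ y)` is positive semidefinite (`quadForm_measureReal_openConn_nonneg`,
`posSemidef_measureReal_openConn`); in particular the two-point function `τ_p` of Bernoulli bond
percolation on `ℤ^d` is a positive-semidefinite kernel for every `d` and every `p`
(`posSemidef_tau`, `quadForm_tau_nonneg`), hence by Herglotz–Bochner its Fourier transform is a
positive measure on the torus. This is the positivity that survives at `q = 1` independently of
reflection positivity; it is blind to `p` (it holds at `p_c` in a jump world too) and says nothing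
about decay — the content of break point 1 of the seat's sharpest statement is that the STRONGER
Källén–Lehmann positivity (a superposition of free propagators), which would force
`τ_{p_c}(0,x) = O(|x|^{2-d})`, is excluded by `η < 0`. [folklore]

Tree anchors: `openConn`, `openGraph`, `tau`, `tau_def`, `tau_comm`, `measurableSet_openConn_holds`; Mathlib
`SimpleGraph.ConnectedComponent.eq`, `Matrix.PosSemidef.of_dotProduct_mulVec_nonneg`,
`MeasureTheory.integral_indicator_one`.
-/

noncomputable section

namespace Summit.CriticalPhenomena.PercolationContinuityZ3.Theorems

open Literature.Probability Literature.Probability.Percolation SimpleGraph MeasureTheory Finset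

variable {ι α V : Type*}

/-! ### Algebra: a fibre kernel is a sum of squares -/

/-- For any map `f : ι → α` and coefficients `c`, the quadratic form of the kernel `1[f i = f j]`
is the sum over the fibres of the squared fibre sums:
`Σ_{i,j∈s} 1[f i = f j] c_i c_j = Σ_{a ∈ f(s)} (Σ_{i∈s, f i = a} c_i)²`. [folklore] -/
theorem sum_sum_ite_eq_eq_sum_sq [DecidableEq α] (s : Finset ι) (f : ι → α) (c : ι → ℝ) :
    ∑ i ∈ s, ∑ j ∈ s, (if f i = f j then c i * c j else 0)
      = ∑ a ∈ s.image f, (∑ i ∈ s, if f i = a then c i else 0) ^ 2 := by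
  have key : ∀ i ∈ s, ∀ j ∈ s,
      ∑ a ∈ s.image f, (if f i = a then c i else 0) * (if f j = a then c j else 0)
        = (if f i = f j then c i * c j else 0) := by
    intro i hi j _
    rw [Finset.sum_eq_single_of_mem (f i) (Finset.mem_image_of_mem f hi)]
    · by_cases h : f i = f j
      · simp [h]
      · have h' : f j ≠ f i := fun e => h e.symm
        simp [h, h']
    · intro a _ ha
      have h' : f i ≠ a := fun e => ha e.symm
      simp [h']
  symm
  calc ∑ a ∈ s.image f, (∑ i ∈ s, if f i = a then c i else 0) ^ 2
      = ∑ a ∈ s.image f, ∑ i ∈ s, ∑ j ∈ s,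
          (if f i = a then c i else 0) * (if f j = a then c j else 0) :=
        Finset.sum_congr rfl fun a _ => by rw [sq, Finset.sum_mul_sum]
    _ = ∑ i ∈ s, ∑ a ∈ s.image f, ∑ j ∈ s,
          (if f i = a then c i else 0) * (if f j = a then c j else 0) := Finset.sum_comm
    _ = ∑ i ∈ s, ∑ j ∈ s, ∑ a ∈ s.image f,
          (if f i = a then c i else 0) * (if f j = a then c j else 0) :=
        Finset.sum_congr rfl fun _ _ => Finset.sum_comm
    _ = ∑ i ∈ s, ∑ j ∈ s, (if f i = f j then c i * c j else 0) :=
        Finset.sum_congr rfl fun i hi => Finset.sum_congr rfl fun j hj => key i hi j hj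

/-- Hence the quadratic form of a fibre kernel is non-negative. [folklore] -/
theorem sum_sum_ite_eq_nonneg [DecidableEq α] (s : Finset ι) (f : ι → α) (c : ι → ℝ) :
    0 ≤ ∑ i ∈ s, ∑ j ∈ s, (if f i = f j then c i * c j else 0) := by
  rw [sum_sum_ite_eq_eq_sum_sq]
  exact Finset.sum_nonneg fun _ _ => sq_nonneg _

/-! ### Pointwise: the connection matrix of one configuration is a Gram matrix -/

/-- For every configuration `ω`, points `x_i` and reals `c_i`:
`Σ_{i,j} c_i c_j 1[x_i ↔ x_j](ω) ≥ 0` — open connection is an equivalence relation, so the kernel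
is the fibre kernel of the map to open clusters (connected components of the open graph). [folklore] -/
theorem quadForm_indicator_openConn_nonneg (ω : BondConfig V) (s : Finset ι) (x : ι → V)
    (c : ι → ℝ) :
    0 ≤ ∑ i ∈ s, ∑ j ∈ s,
      c i * c j * (openConn (x i) (x j) : Set (BondConfig V)).indicator 1 ω := by
  classical
  have h : ∀ i j, c i * c j * (openConn (x i) (x j) : Set (BondConfig V)).indicator 1 ω
      = if (openGraph ω).connectedComponentMk (x i) = (openGraph ω).connectedComponentMk (x j)
        then c i * c j else 0 := by
    intro i j
    rw [SimpleGraph.ConnectedComponent.eq]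
    by_cases hr : (openGraph ω).Reachable (x i) (x j)
    · have hm : ω ∈ (openConn (x i) (x j) : Set (BondConfig V)) := hr
      simp [Set.indicator_of_mem hm, hr]
    · have hm : ω ∉ (openConn (x i) (x j) : Set (BondConfig V)) := hr
      simp [Set.indicator_of_notMem hm, hr]
  simp_rw [h]
  exact sum_sum_ite_eq_nonneg s _ c

/-! ### In the mean: `(x, y) ↦ μ(x ↔ y)` is a positive-semidefinite kernel -/

/-- For any finite measure `μ` on bond configurations over a countable vertex type:
`Σ_{i,j} c_i c_j μ(x_i ↔ x_j) ≥ 0`. [folklore] -/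
theorem quadForm_measureReal_openConn_nonneg [Countable V] (μ : Measure (BondConfig V))
    [IsFiniteMeasure μ] (s : Finset ι) (x : ι → V) (c : ι → ℝ) :
    0 ≤ ∑ i ∈ s, ∑ j ∈ s, c i * c j * μ.real (openConn (x i) (x j) : Set (BondConfig V)) := by
  have hm : ∀ i j, MeasurableSet (openConn (x i) (x j) : Set (BondConfig V)) :=
    fun i j => measurableSet_openConn_holds (x i) (x j)
  have hint : ∀ i j,
      Integrable ((openConn (x i) (x j) : Set (BondConfig V)).indicator (1 : BondConfig V → ℝ)) μ :=
    fun i j => (integrable_const (1 : ℝ)).indicator (hm i j)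
  have hrw : ∑ i ∈ s, ∑ j ∈ s, c i * c j * μ.real (openConn (x i) (x j) : Set (BondConfig V))
      = ∫ ω, ∑ i ∈ s, ∑ j ∈ s,
          c i * c j * (openConn (x i) (x j) : Set (BondConfig V)).indicator 1 ω ∂μ := by
    rw [integral_finsetSum _
      (fun i _ => integrable_finsetSum _ (fun j _ => (hint i j).const_mul _))]
    refine Finset.sum_congr rfl fun i _ => ?_
    rw [integral_finsetSum _ (fun j _ => (hint i j).const_mul _)]
    refine Finset.sum_congr rfl fun j _ => ?_
    rw [integral_const_mul, integral_indicator_one (hm i j)]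
  rw [hrw]
  exact integral_nonneg fun ω => quadForm_indicator_openConn_nonneg ω s x c

/-- Matrix form: for finitely many points `x_i`, the matrix `(μ(x_i ↔ x_j))_{i,j}` is positive
semidefinite (symmetric with non-negative quadratic form). [folklore] -/
theorem posSemidef_measureReal_openConn [Countable V] [Fintype ι] (μ : Measure (BondConfig V))
    [IsFiniteMeasure μ] (x : ι → V) :
    (Matrix.of fun i j => μ.real (openConn (x i) (x j) : Set (BondConfig V))).PosSemidef := by
  classical
  refine Matrix.PosSemidef.of_dotProduct_mulVec_nonneg ?_ ?_
  · refine Matrix.IsHermitian.ext fun i j => ?_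
    -- symmetry `{x ↔ y} = {y ↔ x}` (the tree's `openConn_comm'` lives in a barrier module with a
    -- heavy import cone; two lines here instead)
    have hsymm : (openConn (x i) (x j) : Set (BondConfig V)) = openConn (x j) (x i) := by
      ext ω; exact ⟨fun h => SimpleGraph.Reachable.symm h, fun h => SimpleGraph.Reachable.symm h⟩
    simp [Matrix.of_apply, hsymm]
  · intro v
    have : dotProduct (star v) ((Matrix.of fun i j =>
        μ.real (openConn (x i) (x j) : Set (BondConfig V))).mulVec v)
        = ∑ i, ∑ j, v i * v j * μ.real (openConn (x i) (x j) : Set (BondConfig V)) := by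
      simp only [dotProduct, Matrix.mulVec, Matrix.of_apply, Pi.star_apply, star_trivial,
        Finset.mul_sum]
      refine Finset.sum_congr rfl fun i _ => Finset.sum_congr rfl fun j _ => ?_
      ring
    rw [this]
    exact quadForm_measureReal_openConn_nonneg μ Finset.univ x v

/-! ### Bernoulli percolation on `ℤ^d`: `τ_p` is a positive-semidefinite kernel for every `p` -/

/-- `Σ_{i,j} c_i c_j τ_p(x_i, x_j) ≥ 0` for every `d`, `p`, finitely many sites `x_i` and reals
`c_i`. [folklore] -/
theorem quadForm_tau_nonneg {d : ℕ} (p : unitInterval) (s : Finset ι)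
    (x : ι → LatticeModels.Site d) (c : ι → ℝ) :
    0 ≤ ∑ i ∈ s, ∑ j ∈ s, c i * c j * tau d p (x i) (x j) := by
  simp only [tau_def]
  exact quadForm_measureReal_openConn_nonneg _ s x c

/-- The matrix `(τ_p(x_i, x_j))_{i,j}` is positive semidefinite, for every `d` and `p` — in
particular at `p = p_c(ℤ³)`, whatever the value of `θ(p_c)`. [folklore] -/
theorem posSemidef_tau {d : ℕ} [Fintype ι] (p : unitInterval) (x : ι → LatticeModels.Site d) :
    (Matrix.of fun i j => tau d p (x i) (x j)).PosSemidef := by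
  simp only [tau_def]
  exact posSemidef_measureReal_openConn _ x

/-- The `2 × 2` and Cauchy–Schwarz consequence in closed form: for sites `x, y, z`,
`(τ_p(x,y) − τ_p(x,z))² ≤ 2 (1 − τ_p(y,z))` — nearby points have nearly equal connectivities to
any third point, quantitatively, with no independence or FKG input. [folklore] -/
theorem sq_tau_sub_tau_le {d : ℕ} (p : unitInterval) (x y z : LatticeModels.Site d) :
    (tau d p x y - tau d p x z) ^ 2 ≤ 2 * (1 - tau d p y z) := by
  classical
  -- quadratic form at the three points `(x, y, z)` with coefficients `(t, -1, 1)`, optimised in `t`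
  set a := tau d p x y
  set b := tau d p x z
  set e := tau d p y z
  have hq : ∀ t : ℝ, 0 ≤ t ^ 2 - 2 * t * (a - b) + 2 * (1 - e) := by
    intro t
    have h := quadForm_tau_nonneg p (Finset.univ : Finset (Fin 3)) ![x, y, z] ![t, -1, 1]
    simp only [Fin.sum_univ_three, Matrix.cons_val_zero, Matrix.cons_val_one,
      Matrix.cons_val] at h
    simp only [tau_self] at h
    have e1 : tau d p y x = a := tau_comm p y x
    have e2 : tau d p z x = b := tau_comm p z x
    have e3 : tau d p z y = e := tau_comm p z y
    rw [e1, e2, e3] at h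
    nlinarith [h]
  nlinarith [hq (a - b)]

end Summit.CriticalPhenomena.PercolationContinuityZ3.Theorems
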